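import Mathlib
import HarnessLib
import Summits.HubbardSuperconductivity.HubbardSuperconductivity.Theorems.KLProgrammeKLRegimeEngineScaleOneSrcPackageWDoors
import Summits.HubbardSuperconductivity.HubbardSuperconductivity.Theorems.KLProgrammeKLRegimeEngineScaleOnePackage
import Summits.HubbardSuperconductivity.HubbardSuperconductivity.Theorems.KLProgrammeKLRegimeEngineTowerLevBaseFDisc

/-!
# Route `KLProgramme` — crux K3 ENGINE (stmt-HubbardSuperconductivity-20437 `KLRegimeEngineV17F2`), stub (b) v2, THE LEVELS PACKAGE (ℓ), located item
# «(ℓ)-READOUT-F», (R332)(D)(α′): THE LEVEL-`0` DATUM ROWS AS A THEOREM — the base rows of `𝒱_1[K] @ F_0` (`N_b`, `hcar`, floor-unit law at `J = 0`) for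
# EVERY admissible frame under the level-`0` doors (cell gate-hubbard-kl, seat gate-hubbard-kl-p3 g22; the ENGINE twin of p3 g21's
# `srcPinnedSumW_one_of_doors` / `exists_srcPinnedSumW_one_klSrcBudget` (…ScaleOneSrcPackageWDoors): p3 g20's `kernelNormsWtAt_one_of_bounds` (…ScaleOnePackage,
# p668277) with its space moment, frame size and time moment discharged ∘ k3c3-p2 g15's `baseRowsF_of_wgrid_bigraded` at `d := 1`)

WHY.  After the assembly of record `kernelNormsLevels_all_klEng_final` (k3c3-p2 g16, p696349) the block-`0` inputs of stub (b)'s levels clause are the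
LEVEL-`0` DATUM rows of `kernelNormsLevels_blockZeroF_klEng` (…TowerBlockZeroReadoutFKlEng): an array `Nb₀ t p ≥` every level-`(t+1)` norm of
`𝒱_1 = klTowerInput … 1 1` at `F_0`, with the unit law `Nb₀ t p / klLevUnitF … t p 0 ≤ A_b·λ^{p−1}·Q_b^p` (`p ≥ 3`).  p3 g20's F7 bounds every weighted pinned
sum of `𝒱_1[K]` at `(F_0, rate 0)` for EVERY `FrameOK` frame by an explicit degree budget, modulo the Λ₁ bracket `Ā`, the frame size `k̄K`, a time-moment
witness `C_T`, a space moment `X` and two smallness conditions; p3 g21 discharged exactly these for the source twin (`X := 8(klE4X0+1)` by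
`spaceMoment_klAnisoFamily_zero_le_of_doors`, `k̄K` by `kKbar_le`, `C_T` by `exists_timeMomentConst_klAnisoFamily_zero`, `Ā ≤ D₁(1+ΣGfr)⁴` by `exists_abarOne_le`,
the smallness by `thetaW_smallness_of_le` under product doors on `c` and `U`).  Here the same is done for the engine datum, and the budget — which is
BI-GRADED, `N(2p) = A₁·P₁^p·|U|^{p−1}` for `p ≥ 2` with `A₁ = 4e⁹κ₁⁴/(16e⁹κ₁²Ā)²`, `P₁ = 2κ₁⁻²t²·16e⁹κ₁²Ā`, `t = 2klIsoT + C_T + 8(klE4X0+1)` — is read by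
`baseRowsF_of_wgrid_bigraded (d := 1)` into the three base rows with `A_b = (A₁ε_x)/Klam²/B²`, `Q_b = P₁/ε_x²` (`ε_x = β/(2M)`), at `λ = B·ε_j` for any `B ≥ 1`, `j`.

* §1 **`kernelNormsWtAt_one_of_doors`** — F7 under the doors `c ≤ klEngC₃6 P R`, `U ≤ klEngU₀6 P R c` (space moment, frame size discharged; `Ā`, `θ`-conditions kept);
* §2 **`exists_levelZeroBaseRows_klEng`** — `∀ P R` (well-formed) `∃ A₁ P₁ > 0, ∃ c₀ > 0, ∀ c ≤ c₀, ∃ U₀ > 0`, in the regime, at every volume, for EVERY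
  `FrameOK` frame `K`: `∃ Nb`, nonnegative, dominating every levelled norm of `klTowerInput … 1 1` at `F_0` (`hcar`), with the unit law at `λ = B·ε_j` for every
  `B ≥ 1` and every `j` — the `Nb/hcar/hlawb` binders of `kernelNormsLevels_blockZeroF_klEng` / `readoutLevF_le_levelsRHS_blockZero_sharp` / the assembly-final.
Compositions of landed theorems and real algebra; nothing about the model is asserted beyond them; nothing asserts (ℓ), any stub, K3 or superconductivity.
References: BGM 2006 §2.7 (2.77)–(2.81), §2.8 (2.83), (2.93)–(2.98) [cite: BenfattoGiulianiMastropietro2006].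
-/

noncomputable section

namespace Summit.HubbardSuperconductivity.HubbardSuperconductivity.Theorems.EngineV8

set_option linter.dupNamespace false -- summit = problem name (single-conjunct summit), D-0017

open Real Finset Complex Literature.MathematicalPhysics.QuantumLattice Literature.Probability.LatticeModels Literature.Probability.LatticeModels.BattleFederbush Literature.MathematicalPhysics.QuantumLattice.GrassmannAlgebra
open Summit.HubbardSuperconductivity.HubbardSuperconductivity.Theorems.KLRegimeSplit Summit.HubbardSuperconductivity.HubbardSuperconductivity.Theorems.DispersionFlow
open Summit.HubbardSuperconductivity.HubbardSuperconductivity.Theorems.KLProgrammeLegKernels Summit.HubbardSuperconductivity.HubbardSuperconductivity.Theorems.ScaleZeroDecay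
open scoped ComplexConjugate

variable {L M : ℕ}

/-! ## §1 `kernelNormsWtAt_one_of_bounds` under the doors -/

/-- **THE WEIGHTED PROFILE OF `𝒱_1[K] @ F_0` UNDER THE DOORS `c ≤ klEngC₃6 P R`, `U ≤ klEngU₀6 P R c`**: `kernelNormsWtAt_one_of_bounds` with `X := 8(klE4X0+1)`
(`spaceMoment_klAnisoFamily_zero_le_of_doors`), `k̄K := klE4KapF R·|U| + 2(c/log 4)·klE4Mom R` (`kKbar_le`) and the cutoff profile `klCutoffX5`; the Λ₁ bracket `Ā`
and its two smallness conditions are kept (`t = 2klIsoT + C_T + 8(klE4X0+1)`; engine twin of `srcPinnedSumW_one_of_doors`).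
[cite: BenfattoGiulianiMastropietro2006, §2.7 (2.77)–(2.81)] -/
theorem kernelNormsWtAt_one_of_doors {C_T : ℝ} (hCT0 : 0 ≤ C_T)
    (hCT : ∀ (L M : ℕ) [NeZero L] [NeZero M] (R : RenConsts) (U : ℝ) (N : ℕ) (μ : ℝ) (K : TrigPolyC4v),
      FrameOK R U N μ K → (∀ j, 0 ≤ R.Gfr j) → μ ∈ klWindowC → 16 / 15 * (R.Gfr 0 * |U|) ≤ 1 / 50 → (2 : ℝ) ^ 15 ≤ L →
      ∀ β : ℝ, klBetaMin ≤ β → β ≤ M → klE0 * β ≤ Real.pi * (2 * M - 13) →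
      ∀ (ω : Fin (sectorCount 0)) (c : Fin 2),
        1 / (|β| * (L : ℝ) ^ 2) *
            ∑ dw : TorusSite 1 (2 * (2 * M)) × TorusSite 2 L,
              (β / (2 * (2 * M) : ℕ) * cyclicDist (2 * (2 * M)) (dw.1 0) 0) *
                ‖∑ k : FreqMomentum L M, klAnisoFamily L M β μ K klE0 0 ω k *
                  (if c = 0 then torusChar (fun _ : Fin 1 => ((k.1 : ℕ) : ZMod (2 * (2 * M)))) dw.1 * torusChar k.2 dw.2 else conj (torusChar (fun _ : Fin 1 => ((k.1 : ℕ) : ZMod (2 * (2 * M)))) dw.1 * torusChar k.2 dw.2))‖ ≤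
          C_T * (M / β))
    (P : SplitConsts) (R : RenConsts) (c : ℝ) (hP : P.WF) (hR : R.WF2) (hc : 0 < c) (hc₆ : c ≤ klEngC₃6 P R)
    (μ : ℝ) (hμ : μ ∈ klWindowC) (U : ℝ) (hU : 0 < U) (hU₆ : U ≤ klEngU₀6 P R c) (β : ℝ) (hβ : klBetaMin ≤ β)
    (hβc : β ≤ Real.exp (c / U ^ 2)) (K : TrigPolyC4v) (hK : FrameOK R U (nScales β) μ K) (L M : ℕ) [NeZero L] [NeZero M]
    (hL : klEngL₃ β U ≤ L) (hM : klEngM₃ β U L ≤ M)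
    {Abar : ℝ}
    (hAbar : (14 * Real.sqrt ((1 / 2 + 12 / klScale klE0 1) *
            (2 / klScale klE0 1 + 128 * Real.pi ^ 4 * (4 * (1110 : ℝ) + 6 * (32 / 3) + 2) ^ 2 / klScale klE0 1 +
              2 * Real.pi ^ 5 * (4 * (1110 : ℝ) + 6 * (32 / 3) + 2) ^ 2 / klScale klE0 1 ^ 2 + 1 +
              Real.pi ^ 4 * ((7 : ℝ) ^ 2 * (4 * (1110 : ℝ) + 6 * (32 / 3) + 2) * (2 / klScale klE0 1) + 7 * (2 * (32 / 3) + 1)) ^ 2 /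
                klScale klE0 1 ^ 3))) + uvTimeMomentConst (klScale klE0 1) 7 32 +
        2 * (uvSpaceMomentConst (klScale klE0 1) 1 (uvPieceSq (klScale klE0 1) (uvBaseQ klCutoffX5 (klScale klE0 1) 4) (uvBaseQ' klCutoffX5 (klScale klE0 1) 4)) +
          (1 / 4 * Real.sqrt (216 * (1 / klScale klE0 1 + 1 / 2)) *
              ∑ e : Fin 2 × Fin 2, (uvLinV (klScale klE0 1) (1 + (e.1 : ℕ) + (e.2 : ℕ)) *
                  (klCutoffX5 * ((1 + ((e.1 : ℕ) + (e.2 : ℕ)) + 2).factorial : ℝ) * (4 / klScale klE0 1) ^ (1 + ((e.1 : ℕ) + (e.2 : ℕ)) + 1)) +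
                uvLinD (klScale klE0 1) (1 + (e.1 : ℕ) + (e.2 : ℕ)) *
                  (klCutoffX5 * ((1 + ((e.1 : ℕ) + (e.2 : ℕ)) + 3).factorial : ℝ) * (4 / klScale klE0 1) ^ (1 + ((e.1 : ℕ) + (e.2 : ℕ)) + 2)))) *
            (4608 * (1 + R.Gfr 0 + R.Gfr 1 + R.Gfr 2 + R.Gfr 3) ^ 4 * ((((nScales β : ℕ) : ℝ) + 1) * U ^ 2 + 2 * |U|))) ≤ Abar)
    (hθ1 : 16 * Real.exp 1 ^ 5 * Abar * (klE4KapF R * |U| + 2 * (c / Real.log 4) * klE4Mom R) ≤ 1)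
    (hθ2 : 64 * Real.exp 1 ^ 9 * (Real.sqrt (2 * (7 + 6047)) + Real.sqrt 6047) ^ 2 * Abar * |U| ≤ 1)
    (N : ℕ → ℝ) (hNodd : ∀ m, Odd m → 0 ≤ N m)
    (hN2 : 2 * (2 * klIsoT + C_T + 8 * (klE4X0 + 1)) ^ 2 *
        (Real.exp 1 ^ 5 * (klE4KapF R * |U| + 2 * (c / Real.log 4) * klE4Mom R) +
          4 * Real.exp 1 ^ 9 * (Real.sqrt (2 * (7 + 6047)) + Real.sqrt 6047) ^ 2 * |U|) ≤ N 2)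
    (hNp : ∀ p, 2 ≤ p → 2 ^ p * (4 * Real.exp 1 ^ 9 * (Real.sqrt (2 * (7 + 6047)) + Real.sqrt 6047) ^ 4 * ((Real.sqrt (2 * (7 + 6047)) + Real.sqrt 6047))⁻¹ ^ (2 * p) *
        (2 * klIsoT + C_T + 8 * (klE4X0 + 1)) ^ (2 * p) *
          (16 * Real.exp 1 ^ 9 * (Real.sqrt (2 * (7 + 6047)) + Real.sqrt 6047) ^ 2 * Abar * |U|) ^ (p - 2) * |U|) ≤ N (2 * p)) :
    ∀ (m : ℕ) (q : Fin m) (w : SpaceTimeIdx L M × SectorLeg (sectorCount 0)),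
      klWtPinnedSumAt L M β μ K 0 0 m (klEffectiveAction L M β U μ K klE0 1) q w ≤ N m := by
  have hRwf : R.WF := hR.wf
  have hc₃ : c ≤ klEngC₃3 P R := hc₆.trans (klEngC₃6_le_klEngC₃3 P R)
  have hcD : c ≤ klE4C₃ R := hc₆.trans (klEngC₃6_le_klE4C₃ P R)
  have hU₀ : U ≤ klEngU₀3 P R c := hU₆.trans (klEngU₀6_le_klEngU₀3 P R c)
  have hUD : U ≤ klE4U₀ R := hU₆.trans (klEngU₀6_le_klE4U₀ P R c)
  have hU1 : |U| ≤ 1 := abs_le_one_of_le_klEngU₀3 hU hU₀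
  have hκU : 16 / 15 * (R.Gfr 0 * |U|) ≤ 1 / 50 := gfr0_abs_mul_le_of_le_klEngU₀3 hU hU₀
  obtain ⟨hL15, -, -, -, hβ3M, -⟩ := scaleZero_regime_sizes hβ hL hM
  have hN := nScales_succ_mul_sq_le (U := U) hc.le hβ hβc
  have hX0 : 0 ≤ klE4X0 := uvSpaceMomentConst_nonneg _ _ _
  exact kernelNormsWtAt_one_of_bounds hCT0 hCT (X := 8 * (klE4X0 + 1)) (by positivity) P R c hP hR hc hc₃ μ hμ U hU hU₀ β hβ hβc K hK L M
    hL hM one_le_klCutoffX5 norm_iteratedDeriv_salmhoferCutoff_le_klCutoffX5 hAbar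
    (kKbar := klE4KapF R * |U| + 2 * (c / Real.log 4) * klE4Mom R) (kKbar_le hRwf hN) hθ1 hθ2
    (fun ω c' => spaceMoment_klAnisoFamily_zero_le_of_doors hK hRwf hU hU1 hUD hc.le hcD hμ hκU hL15 hβ hβc hβ3M ω c') N hNodd hN2 hNp

/-! ## §2 The level-`0` base rows, packaged for every admissible frame -/

set_option maxHeartbeats 400000 in -- the door bookkeeping + the bi-graded budget algebra
/-- **THE LEVEL-`0` DATUM ROWS OF (α′), AS A THEOREM** — for every well-formed `P R` there are `A₁, P₁ > 0` and doors `c₀`, `U₀` such that in the regime, at every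
volume above `(klEngL₃, klEngM₃)` and for EVERY admissible frame `K` (`FrameOK R U (nScales β) μ K`), an array `Nb : Fin 5 → ℕ → ℝ` exists with: `Nb ≥ 0`;
every levelled norm of `𝒱_1 = klTowerInput … 1 1` at `F_0` of level `t + 1` in degree `2p` is `≤ Nb t p`; and for every `B ≥ 1`, every `j` and every `p ≥ 3`,
`Nb t p / klLevUnitF β M t p 0 ≤ (A₁·ε_x/Klam²/B²)·(B·ε_j)^{p−1}·(P₁/ε_x²)^p` (`ε_x = imagTimeWeight β M`) — the `Nb/hcar/hlawb` binders of
`kernelNormsLevels_blockZeroF_klEng` and of the assembly of record. [cite: BenfattoGiulianiMastropietro2006, §2.7 (2.77)–(2.81), §2.8 (2.83), (2.93)–(2.98)] -/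
theorem exists_levelZeroBaseRows_klEng (P : SplitConsts) (R : RenConsts) (hP : P.WF) (hR : R.WF2) :
    ∃ A₁ P₁ : ℝ, 0 < A₁ ∧ 0 < P₁ ∧ ∃ c₀ : ℝ, 0 < c₀ ∧ ∀ c : ℝ, 0 < c → c ≤ c₀ → ∃ U₀ : ℝ, 0 < U₀ ∧
      ∀ μ ∈ klWindowC, ∀ U : ℝ, 0 < U → U ≤ U₀ → ∀ β : ℝ, klBetaMin ≤ β → β ≤ Real.exp (c / U ^ 2) →
        ∀ (L M : ℕ) [NeZero L] [NeZero M], klEngL₃ β U ≤ L → klEngM₃ β U L ≤ M →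
          ∀ K : TrigPolyC4v, FrameOK R U (nScales β) μ K →
            ∃ Nb : Fin 5 → ℕ → ℝ, (∀ t p, 0 ≤ Nb t p) ∧
              (∀ (t : Fin 5) (p : ℕ) (Ωe' : Fin (2 * p) → Option (SectorLeg (sectorCount 0))), levelCount Ωe' = (t : ℕ) + 1 →
                klLevNormOf L M β μ K 0 (2 * p) (klTowerInput L M β U μ K 1 1) Ωe' ≤ Nb t p) ∧
              ∀ (B : ℝ), 1 ≤ B → ∀ (j : ℕ) (t : Fin 5) (p : ℕ), 3 ≤ p →
                Nb t p / klLevUnitF β M t p 0 ≤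
                  (A₁ * imagTimeWeight β M / P.Klam ^ 2 / B ^ 2) * (B * epsCoupling P U j) ^ (p - 1) * (P₁ / imagTimeWeight β M ^ 2) ^ p := by
  obtain ⟨C_T, hCT0, hCT⟩ := exists_timeMomentConst_klAnisoFamily_zero
  obtain ⟨D₁, hD₁, hbr⟩ := exists_abarOne_le
  have hRwf : R.WF := hR.wf
  have hG : ∀ j, 0 ≤ R.Gfr j := hRwf.2.2
  have hX0 : 0 ≤ klE4X0 := uvSpaceMomentConst_nonneg _ _ _
  have he1 : 1 ≤ Real.exp 1 := Real.one_le_exp (by norm_num)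
  have he0 : 0 < Real.exp 1 := Real.exp_pos 1
  have h4 : 0 < Real.log 4 := Real.log_pos (by norm_num)
  have hKF := one_le_klE4KapF R
  have hK1 : 1 ≤ P.Klam := hP.1
  have hK0 : 0 < P.Klam := lt_of_lt_of_le one_pos hK1
  -- the R-keyed bracket majorant `Ā := D₁·(1 + ΣGfr)⁴ ≥ 1`
  set g : ℝ := (1 + R.Gfr 0 + R.Gfr 1 + R.Gfr 2 + R.Gfr 3) ^ 4 with hg
  have hg1 : 1 ≤ g := by
    rw [hg]
    have : (1 : ℝ) ≤ 1 + R.Gfr 0 + R.Gfr 1 + R.Gfr 2 + R.Gfr 3 := by linarith [hG 0, hG 1, hG 2, hG 3]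
    exact one_le_pow₀ this
  set Abar : ℝ := D₁ * g with hAbarD
  have hAbar1 : 1 ≤ Abar := one_le_mul_of_one_le_of_one_le hD₁ hg1
  have hAbarpos : 0 < Abar := lt_of_lt_of_le one_pos hAbar1
  have hAbar0 : 0 ≤ Abar := hAbarpos.le
  set κ₁ : ℝ := Real.sqrt (2 * (7 + 6047)) + Real.sqrt 6047 with hκ₁
  have hκ₁1 : 1 ≤ κ₁ ^ 2 := by
    have h1 : (1 : ℝ) ≤ Real.sqrt (2 * (7 + 6047)) := by
      rw [show (1 : ℝ) = Real.sqrt 1 by simp]; exact Real.sqrt_le_sqrt (by norm_num)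
    have h2 : 0 ≤ Real.sqrt 6047 := Real.sqrt_nonneg _
    have h3 : (1 : ℝ) ≤ κ₁ := by rw [hκ₁]; linarith
    exact one_le_pow₀ h3
  have hκ₁pos : 0 < κ₁ := by
    rw [hκ₁]; exact add_pos_of_pos_of_nonneg (Real.sqrt_pos.2 (by norm_num)) (Real.sqrt_nonneg _)
  have hKFpos : 0 < klE4KapF R := lt_of_lt_of_le one_pos hKF
  have hMom1 : 0 < klE4Mom R + 1 := by have := klE4Mom_nonneg R; linarith
  set t : ℝ := 2 * klIsoT + C_T + 8 * (klE4X0 + 1) with ht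
  have ht0 : 0 < t := by have := klIsoT_nonneg; rw [ht]; positivity
  -- the bi-graded constants of the budget
  set A₁ : ℝ := 4 * Real.exp 1 ^ 9 * κ₁ ^ 4 / (16 * Real.exp 1 ^ 9 * κ₁ ^ 2 * Abar) ^ 2 with hA₁
  set P₁ : ℝ := 2 * (κ₁⁻¹) ^ 2 * t ^ 2 * (16 * Real.exp 1 ^ 9 * κ₁ ^ 2 * Abar) with hP₁
  have hA₁0 : 0 < A₁ := by rw [hA₁]; positivity
  have hP₁0 : 0 < P₁ := by rw [hP₁]; positivity
  refine ⟨A₁, P₁, hA₁0, hP₁0, ?_⟩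
  -- the c-door
  set c₀ : ℝ := min (klEngC₃6 P R) (Real.log 4 / (128 * Real.exp 1 ^ 5 * Abar * (klE4Mom R + 1))) with hc₀
  refine ⟨c₀, lt_min (klEngC₃6_pos P R) (by positivity), fun c hc hcc₀ => ?_⟩
  have hc₆ : c ≤ klEngC₃6 P R := hcc₀.trans (min_le_left _ _)
  have hcd' : c ≤ Real.log 4 / (128 * Real.exp 1 ^ 5 * Abar * (klE4Mom R + 1)) := hcc₀.trans (min_le_right _ _)
  have hcd : 128 * Real.exp 1 ^ 5 * Abar * (klE4Mom R + 1) * (c / Real.log 4) ≤ 1 := by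
    have hden : 0 < 128 * Real.exp 1 ^ 5 * Abar * (klE4Mom R + 1) := by positivity
    rw [le_div_iff₀ hden] at hcd'
    rw [show 128 * Real.exp 1 ^ 5 * Abar * (klE4Mom R + 1) * (c / Real.log 4) =
      128 * Real.exp 1 ^ 5 * Abar * (klE4Mom R + 1) * c / Real.log 4 by ring, div_le_one h4]
    linarith
  -- the U-door
  set U₀ : ℝ := min (klEngU₀6 P R c) (1 / (128 * Real.exp 1 ^ 9 * κ₁ ^ 2 * Abar * klE4KapF R)) with hU₀
  refine ⟨U₀, lt_min (klEngU₀6_pos P R c) (by positivity), fun μ hμ U hU hUU₀ β hβ hβc L M _ _ hL hM K hK => ?_⟩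
  have hU₆ : U ≤ klEngU₀6 P R c := hUU₀.trans (min_le_left _ _)
  have hUd' : U ≤ 1 / (128 * Real.exp 1 ^ 9 * κ₁ ^ 2 * Abar * klE4KapF R) := hUU₀.trans (min_le_right _ _)
  have hUd : 128 * Real.exp 1 ^ 9 * κ₁ ^ 2 * Abar * klE4KapF R * U ≤ 1 := by
    have hden : 0 < 128 * Real.exp 1 ^ 9 * κ₁ ^ 2 * Abar * klE4KapF R := by positivity
    rw [le_div_iff₀ hden] at hUd'; linarith
  obtain ⟨hθ1, hθ2⟩ := thetaW_smallness_of_le (cl := c / Real.log 4) he1 hκ₁1 hAbar0 hKF hU (div_nonneg hc.le h4.le) hUd hcd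
  have hU₀3 : U ≤ klEngU₀3 P R c := hU₆.trans (klEngU₀6_le_klEngU₀3 P R c)
  have hU1 : |U| ≤ 1 := abs_le_one_of_le_klEngU₀3 hU hU₀3
  have hcD : c ≤ klE4C₃ R := hc₆.trans (klEngC₃6_le_klE4C₃ P R)
  have hNsc := nScales_succ_mul_sq_le (U := U) hc.le hβ hβc
  have hhalf := div_log_four_le_half_of_door hcD
  have hAbar := (hbr R U (nScales β) hRwf hU1 (hNsc.trans hhalf)).trans (le_of_eq hAbarD.symm)
  have hβ0 : 0 < β := beta_pos_of_klBetaMin_le hβ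
  have hε : 0 < imagTimeWeight β M := by
    unfold imagTimeWeight
    have : (0 : ℝ) < M := Nat.cast_pos.2 (Nat.pos_of_ne_zero (NeZero.ne M))
    positivity
  -- the budget: degree 2, the bi-graded closed form `A₁·P₁^p·|U|^{p−1}` in degrees `2p ≥ 4`, `0` elsewhere
  set kK : ℝ := klE4KapF R * |U| + 2 * (c / Real.log 4) * klE4Mom R with hkK
  have hkK0 : 0 ≤ kK := by rw [hkK]; have := klE4Mom_nonneg R; positivity
  set Nw : ℕ → ℝ := fun p => if p = 1 then 2 * t ^ 2 * (Real.exp 1 ^ 5 * kK + 4 * Real.exp 1 ^ 9 * κ₁ ^ 2 * |U|)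
    else if 2 ≤ p then A₁ * P₁ ^ p * |U| ^ (p - 1) else 0 with hNw
  have hNw0 : ∀ p, 0 ≤ Nw p := by
    intro p
    simp only [hNw]
    split_ifs
    · positivity
    · positivity
    · exact le_rfl
  set N : ℕ → ℝ := fun m => if Even m then Nw (m / 2) else 0 with hN
  have hNodd : ∀ m, Odd m → 0 ≤ N m := fun m hm => by
    simp only [hN, Nat.not_even_iff_odd.2 hm, if_false]; exact le_rfl
  have hNeven : ∀ p, N (2 * p) = Nw p := fun p => by
    simp only [hN, even_two_mul, if_true, Nat.mul_div_cancel_left p two_pos]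
  have hN2 : 2 * (2 * klIsoT + C_T + 8 * (klE4X0 + 1)) ^ 2 * (Real.exp 1 ^ 5 * (klE4KapF R * |U| + 2 * (c / Real.log 4) * klE4Mom R) +
      4 * Real.exp 1 ^ 9 * (Real.sqrt (2 * (7 + 6047)) + Real.sqrt 6047) ^ 2 * |U|) ≤ N 2 := by
    have h21 : N 2 = Nw 1 := hNeven 1
    have hNw1 : Nw 1 = 2 * t ^ 2 * (Real.exp 1 ^ 5 * kK + 4 * Real.exp 1 ^ 9 * κ₁ ^ 2 * |U|) := by simp [hNw]
    rw [h21, hNw1, ht, hkK, hκ₁]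
  -- the literal budget of degree `2p ≥ 4` IS `A₁·P₁^p·|U|^{p−1}`
  have hlit : ∀ p, 2 ≤ p → 2 ^ p * (4 * Real.exp 1 ^ 9 * (Real.sqrt (2 * (7 + 6047)) + Real.sqrt 6047) ^ 4 *
      ((Real.sqrt (2 * (7 + 6047)) + Real.sqrt 6047))⁻¹ ^ (2 * p) * (2 * klIsoT + C_T + 8 * (klE4X0 + 1)) ^ (2 * p) *
        (16 * Real.exp 1 ^ 9 * (Real.sqrt (2 * (7 + 6047)) + Real.sqrt 6047) ^ 2 * Abar * |U|) ^ (p - 2) * |U|) = A₁ * P₁ ^ p * |U| ^ (p - 1) := by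
    intro p hp
    obtain ⟨p', rfl⟩ : ∃ p', p = p' + 2 := ⟨p - 2, by omega⟩
    rw [← hκ₁, ← ht, Nat.add_sub_cancel, show p' + 2 - 1 = p' + 1 by omega]
    set W : ℝ := 16 * Real.exp 1 ^ 9 * κ₁ ^ 2 * Abar with hWdef
    have hW0 : 0 < W := by rw [hWdef]; positivity
    have hAW2 : A₁ * W ^ 2 = 4 * Real.exp 1 ^ 9 * κ₁ ^ 4 := by rw [hA₁]; field_simp
    rw [hP₁, mul_pow (2 * κ₁⁻¹ ^ 2 * t ^ 2) W (p' + 2), mul_pow (2 * κ₁⁻¹ ^ 2) (t ^ 2) (p' + 2), mul_pow (2 : ℝ) (κ₁⁻¹ ^ 2) (p' + 2),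
      ← pow_mul κ₁⁻¹ 2 (p' + 2), ← pow_mul t 2 (p' + 2), mul_pow W |U| p', pow_succ |U| p', pow_add W p' 2]
    clear_value W A₁ P₁ κ₁ t Abar kK Nw N
    generalize (2 : ℝ) ^ (p' + 2) = n2
    generalize κ₁⁻¹ ^ (2 * (p' + 2)) = a
    generalize t ^ (2 * (p' + 2)) = b
    generalize W ^ p' = w
    generalize |U| ^ p' = u
    linear_combination (-(n2 * a * b * w * u * |U|)) * hAW2
  have hNp : ∀ p, 2 ≤ p → 2 ^ p * (4 * Real.exp 1 ^ 9 * (Real.sqrt (2 * (7 + 6047)) + Real.sqrt 6047) ^ 4 *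
      ((Real.sqrt (2 * (7 + 6047)) + Real.sqrt 6047))⁻¹ ^ (2 * p) * (2 * klIsoT + C_T + 8 * (klE4X0 + 1)) ^ (2 * p) *
        (16 * Real.exp 1 ^ 9 * (Real.sqrt (2 * (7 + 6047)) + Real.sqrt 6047) ^ 2 * Abar * |U|) ^ (p - 2) * |U|) ≤ N (2 * p) := by
    intro p hp
    rw [hlit p hp, hNeven p]
    simp only [hNw, show p ≠ 1 by omega, if_false, hp, if_true]
    exact le_rfl
  -- F7 under the doors: every weighted pinned sum of `𝒱_1[K]` at `(F_0, rate 0)` is within the budget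
  have hfull := kernelNormsWtAt_one_of_doors hCT0 hCT P R c hP hR hc hc₆ μ hμ U hU hU₆ β hβ hβc K hK L M hL hM hAbar hθ1 hθ2 N hNodd hN2 hNp
  have hgrid : ∀ p, 1 ≤ p → ∀ (q : Fin (2 * p)) (w : SpaceTimeIdx L M × SectorLeg (sectorCount (1 - 1))),
      klWtPinnedSumAt L M β μ K (1 - 1) 0 (2 * p) (klTowerInput L M β U μ K 1 1) q w ≤ Nw p := by
    intro p _ q w
    rw [← hNeven p]
    unfold klTowerInput
    exact hfull (2 * p) q w
  -- the bi-graded reading with `Ag := A₁·ε_x`, `Pg := P₁/ε_x²`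
  have hbi : ∀ p, 3 ≤ p → Nw p ≤ imagTimeWeight β M ^ (2 * p - 1) * (A₁ * imagTimeWeight β M) * (P₁ / imagTimeWeight β M ^ 2) ^ p * |U| ^ (p - 1) := by
    intro p hp
    have hval : Nw p = A₁ * P₁ ^ p * |U| ^ (p - 1) := by
      simp only [hNw, show p ≠ 1 by omega, if_false, show 2 ≤ p by omega, if_true]
    rw [hval]
    apply le_of_eq
    obtain ⟨p', rfl⟩ : ∃ p', p = p' + 1 := ⟨p - 1, by omega⟩
    have hεne : imagTimeWeight β M ≠ 0 := hε.ne'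
    rw [show 2 * (p' + 1) - 1 = 2 * p' + 1 by omega, div_pow, ← pow_mul, Nat.add_sub_cancel]
    clear_value A₁ P₁ κ₁ t Abar kK Nw N
    generalize imagTimeWeight β M = ε at hεne ⊢
    generalize |U| ^ p' = u
    generalize P₁ ^ (p' + 1) = q
    field_simp
    ring
  -- the base rows at `d := 1`: nonnegativity and `hcar` once, the unit law for every `B ≥ 1`, `j`
  have hBK1 : 1 ≤ (1 : ℝ) * P.Klam := by rw [one_mul]; exact hK1
  have hle1 : 1 * P.Klam * |U| ≤ 1 * epsCoupling P U 0 := by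
    rw [one_mul, one_mul]; unfold epsCoupling
    exact mul_le_mul_of_nonneg_left (le_add_of_nonneg_right (by positivity)) hK0.le
  obtain ⟨hNb0, hcar, -⟩ := baseRowsF_of_wgrid_bigraded (L := L) (M := M) hβ0 U μ K 1 0 Nw hNw0 hgrid (by positivity : 0 ≤ A₁ * imagTimeWeight β M)
    (by positivity : 0 ≤ P₁ / imagTimeWeight β M ^ 2) hbi hK0 hBK1 hle1
  refine ⟨fun _ p => Nw p, hNb0, hcar, fun B hB j t p hp => ?_⟩
  have hB0 : 0 < B := lt_of_lt_of_le one_pos hB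
  have hBK : 1 ≤ B * P.Klam := one_le_mul_of_one_le_of_one_le hB hK1
  have hle : B * P.Klam * |U| ≤ B * epsCoupling P U j := by
    unfold epsCoupling
    have h1 : |U| ≤ |U| + U ^ 2 * (j : ℝ) := le_add_of_nonneg_right (by positivity)
    calc B * P.Klam * |U| = B * (P.Klam * |U|) := by ring
      _ ≤ B * (P.Klam * (|U| + U ^ 2 * (j : ℝ))) := mul_le_mul_of_nonneg_left (mul_le_mul_of_nonneg_left h1 hK0.le) hB0.le
  obtain ⟨-, -, hlawb⟩ := baseRowsF_of_wgrid_bigraded (L := L) (M := M) hβ0 U μ K 1 0 Nw hNw0 hgrid (by positivity : 0 ≤ A₁ * imagTimeWeight β M)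
    (by positivity : 0 ≤ P₁ / imagTimeWeight β M ^ 2) hbi hK0 hBK hle
  have h := hlawb t p hp
  simp only [Nat.sub_self, Nat.mul_zero, pow_zero, one_mul, div_one] at h
  exact h

end Summit.HubbardSuperconductivity.HubbardSuperconductivity.Theorems.EngineV8

end
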